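import Summits.Schanuel.Schanuel.Theorems.SoloInformedAE1tauGelfondInput
import HarnessLib.Audit.Tags

/-!
# Solo-informed toy line: the dilated family `(P(aT))^{[j]}` of [Roy2010, Thm 1.1 (6) / §9]

Packaging for THEOREM AE-2 (η = 0) of the seat's AE-note (§9, steps (a)–(b)), no new
mathematics: for an integer polynomial `P` and an integer `a` the dilate `P(aT) = P.comp (C a * X)`
has

* `(P(aT))^{[j]} = a^j · (P^{[j]})(aT)` and
  `((P(aT))^{[j]})^{[h]} = a^{j+h} · ((P^{[j]})^{[h]})(aT)`
  (coefficientwise: the coefficient of `X^i` in `P(aT)` is `a^i · coeff P i`);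
* `P(aT) ≠ 0` when `P ≠ 0`, `a ≠ 0`; `deg P(aT) ≤ deg P`;
  `‖P(aT)‖_∞ ≤ a^{deg P} ‖P‖_∞` for `a ≥ 1`;
* values: `((P(aT))^{[j]})^{[h]}(cξ) = a^{j+h} (P^{[j]})^{[h]}(acξ)`, so for
  `P ∈ RoyAdditiveSmall ξ β σ τ ν n`, `ac ≤ n^σ` and `j + h ≤ n^τ` its modulus is
  `≤ (2a)^{j+h} exp(-n^ν)`.

These feed the pointwise transfer `soloPT_few_bad_points_card` ([Roy2010, Cor 3.2]) at the
scale `K' = ⌊n^{σ-μ}⌋` with the family indexed by `(a, j) ∈ primesLe(n^μ) × [0, t)`.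

References: [Roy2010] D. Roy, Small value estimates for the additive group,
Int. J. Number Theory 6 (2010), arXiv:0708.2307, §9.
-/

namespace Summit.Schanuel.Schanuel.Theorems

open Polynomial Finset

/-! ### Part A. Divided derivatives of a dilate -/

/-- `(P(aT))^{[j]} = a^j · (P^{[j]})(aT)`: both sides have `X^i`-coefficient
`C(i+j, j) a^{i+j} coeff P (i+j)`. -/
theorem soloDL_hasseDeriv_comp_C_mul_X (P : ℤ[X]) (a : ℤ) (j : ℕ) :
    hasseDeriv j (P.comp (C a * X)) = C (a ^ j) * (hasseDeriv j P).comp (C a * X) := by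
  ext i
  simp only [hasseDeriv_coeff, comp_C_mul_X_coeff, coeff_C_mul]
  ring

/-- Second-order version: `((P(aT))^{[j]})^{[h]} = a^{j+h} · ((P^{[j]})^{[h]})(aT)`. -/
theorem soloDL_hasseDeriv_hasseDeriv_comp (P : ℤ[X]) (a : ℤ) (j h : ℕ) :
    hasseDeriv h (hasseDeriv j (P.comp (C a * X))) =
      C (a ^ (j + h)) * (hasseDeriv h (hasseDeriv j P)).comp (C a * X) := by
  ext i
  simp only [hasseDeriv_coeff, comp_C_mul_X_coeff, coeff_C_mul]
  ring

/-- A dilate of a non-zero integer polynomial by a non-zero integer is non-zero. -/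
theorem soloDL_comp_ne_zero {P : ℤ[X]} (hP : P ≠ 0) {a : ℤ} (ha : a ≠ 0) :
    P.comp (C a * X) ≠ 0 :=
  fun h => hP ((comp_C_mul_X_eq_zero_iff (mem_nonZeroDivisors_of_ne_zero ha)).mp h)

/-- The dilate has degree at most `deg P`. -/
theorem soloDL_natDegree_comp_le (P : ℤ[X]) (a : ℤ) :
    (P.comp (C a * X)).natDegree ≤ P.natDegree := by
  refine natDegree_le_iff_coeff_eq_zero.mpr ?_
  intro N hN
  rw [comp_C_mul_X_coeff, coeff_eq_zero_of_natDegree_lt hN, zero_mul]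

/-- Members of the dilated family are non-zero: `(P(aT))^{[j]} ≠ 0` for `P ≠ 0`, `a ≠ 0`,
`j ≤ deg P`. -/
theorem soloDL_hasseDeriv_comp_ne_zero {P : ℤ[X]} (hP : P ≠ 0) {a : ℤ} (ha : a ≠ 0)
    {j : ℕ} (hj : j ≤ P.natDegree) : hasseDeriv j (P.comp (C a * X)) ≠ 0 := by
  rw [soloDL_hasseDeriv_comp_C_mul_X]
  exact mul_ne_zero (C_ne_zero.mpr (pow_ne_zero _ ha))
    (soloDL_comp_ne_zero (soloDG_hasseDeriv_ne_zero hP hj) ha)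

/-- Members of the dilated family have degree `≤ deg P`. -/
theorem soloDL_natDegree_hasseDeriv_comp_le (P : ℤ[X]) (a : ℤ) (j : ℕ) :
    (hasseDeriv j (P.comp (C a * X))).natDegree ≤ P.natDegree :=
  ((natDegree_hasseDeriv_le _ _).trans (Nat.sub_le _ _)).trans (soloDL_natDegree_comp_le P a)

/-! ### Part B. Heights -/

/-- `‖P(aT)‖_∞ ≤ a^{deg P} · ‖P‖_∞` for a natural number `a ≥ 1`. -/
theorem soloDL_supNorm_comp_le (P : ℤ[X]) {a : ℕ} (ha : 1 ≤ a) :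
    (P.comp (C (a : ℤ) * X)).supNorm ≤ (a : ℝ) ^ P.natDegree * P.supNorm := by
  obtain ⟨i, hi⟩ := (P.comp (C (a : ℤ) * X)).exists_eq_supNorm
  rw [hi, comp_C_mul_X_coeff]
  by_cases hle : i ≤ P.natDegree
  · rw [norm_mul, norm_pow, mul_comm]
    have ha' : ‖((a : ℕ) : ℤ)‖ = (a : ℝ) := by
      rw [Int.norm_eq_abs, Int.cast_natCast, Nat.abs_cast]
    rw [ha']
    have ha1 : (1 : ℝ) ≤ a := by exact_mod_cast ha
    exact mul_le_mul (pow_le_pow_right₀ ha1 hle) (P.le_supNorm i) (norm_nonneg _)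
      (by positivity)
  · rw [coeff_eq_zero_of_natDegree_lt (not_le.mp hle), zero_mul, norm_zero]
    exact mul_nonneg (by positivity) P.supNorm_nonneg

/-- Height of a member of the dilated family: `‖(P(aT))^{[j]}‖_∞ ≤ (2a)^n · ‖P‖_∞`
when `deg P ≤ n`, `a ≥ 1`. -/
theorem soloDL_supNorm_hasseDeriv_comp_le {P : ℤ[X]} {n : ℕ} (hdeg : P.natDegree ≤ n)
    {a : ℕ} (ha : 1 ≤ a) (j : ℕ) :
    (hasseDeriv j (P.comp (C (a : ℤ) * X))).supNorm ≤ (2 * a : ℝ) ^ n * P.supNorm := by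
  have ha1 : (1 : ℝ) ≤ a := by exact_mod_cast ha
  have h1 := soloDG_supNorm_hasseDeriv_le (P.comp (C (a : ℤ) * X)) j
  have h2 : (2 : ℝ) ^ (P.comp (C (a : ℤ) * X)).natDegree ≤ 2 ^ n :=
    pow_le_pow_right₀ (by norm_num) ((soloDL_natDegree_comp_le P a).trans hdeg)
  have h3 : (a : ℝ) ^ P.natDegree ≤ (a : ℝ) ^ n := pow_le_pow_right₀ ha1 hdeg
  calc (hasseDeriv j (P.comp (C (a : ℤ) * X))).supNorm
      ≤ 2 ^ (P.comp (C (a : ℤ) * X)).natDegree * (P.comp (C (a : ℤ) * X)).supNorm := h1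
    _ ≤ 2 ^ n * ((a : ℝ) ^ n * P.supNorm) :=
        mul_le_mul h2 ((soloDL_supNorm_comp_le P ha).trans
          (mul_le_mul_of_nonneg_right h3 P.supNorm_nonneg)) (supNorm_nonneg _)
          (by positivity)
    _ = (2 * a : ℝ) ^ n * P.supNorm := by rw [mul_pow]; ring

/-- The same with the naive height of the toy node:
`‖(P(aT))^{[j]}‖_∞ ≤ (2a)^n · polyHeight P`. -/
theorem soloDL_supNorm_hasseDeriv_comp_le_polyHeight {P : ℤ[X]} {n : ℕ}
    (hdeg : P.natDegree ≤ n) {a : ℕ} (ha : 1 ≤ a) (j : ℕ) :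
    (hasseDeriv j (P.comp (C (a : ℤ) * X))).supNorm ≤
      (2 * a : ℝ) ^ n * (polyHeight P : ℝ) :=
  (soloDL_supNorm_hasseDeriv_comp_le hdeg ha j).trans
    (mul_le_mul_of_nonneg_left (supNorm_le_polyHeight P) (by positivity))

/-! ### Part C. Values at the points `cξ` -/

/-- Evaluation of a dilate: `(G(aT))(z) = G(az)`. -/
theorem soloDL_aeval_comp_C_mul_X (G : ℤ[X]) (a : ℤ) (z : ℂ) :
    aeval z (G.comp (C a * X)) = aeval ((a : ℂ) * z) G := by
  rw [aeval_comp]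
  congr 1
  simp

/-- Exact value formula: `((P(aT))^{[j]})^{[h]}(z) = a^{j+h} · (P^{[j]})^{[h]}(az)`. -/
theorem soloDL_aeval_hasseDeriv_hasseDeriv_comp (P : ℤ[X]) (a : ℤ) (j h : ℕ) (z : ℂ) :
    aeval z (hasseDeriv h (hasseDeriv j (P.comp (C a * X)))) =
      (a : ℂ) ^ (j + h) * aeval ((a : ℂ) * z) (hasseDeriv h (hasseDeriv j P)) := by
  rw [soloDL_hasseDeriv_hasseDeriv_comp, map_mul, aeval_C, soloDL_aeval_comp_C_mul_X]
  simp

/-- **Value bound for the dilated family.** For `P ∈ RoyAdditiveSmall ξ β σ τ ν n`, natural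
numbers `a, c` with `ac ≤ n^σ` and orders `j + h ≤ n^τ`:
`‖((P(aT))^{[j]})^{[h]}(cξ)‖ ≤ (2a)^{j+h} · exp(-n^ν)`. -/
theorem soloDL_norm_aeval_le {ξ : ℂ} {β σ τ ν : ℝ} {n : ℕ} {P : ℤ[X]}
    (hP : P ∈ RoyAdditiveSmall ξ β σ τ ν n) {a c : ℕ}
    (hac : ((a * c : ℕ) : ℝ) ≤ (n : ℝ) ^ σ) {j h : ℕ}
    (hjh : ((j + h : ℕ) : ℝ) ≤ (n : ℝ) ^ τ) :
    ‖aeval ((c : ℂ) * ξ)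
        (hasseDeriv h (hasseDeriv j (P.comp (C ((a : ℕ) : ℤ) * X))))‖ ≤
      (2 * a : ℝ) ^ (j + h) * Real.exp (-(n : ℝ) ^ ν) := by
  rw [soloDL_aeval_hasseDeriv_hasseDeriv_comp, norm_mul, norm_pow]
  have ha : ‖(((a : ℕ) : ℤ) : ℂ)‖ = (a : ℝ) := by
    rw [Int.cast_natCast, Complex.norm_natCast]
  rw [ha]
  have hz : ((((a : ℕ) : ℤ) : ℂ) * ((c : ℂ) * ξ)) = (((a * c : ℕ) : ℂ) * ξ) := by
    push_cast
    ring
  rw [hz]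
  have h2 := soloDG_norm_aeval_hasseDeriv_hasseDeriv_le P (((a * c : ℕ) : ℂ) * ξ) h j
  have h3 : ‖aeval (((a * c : ℕ) : ℂ) * ξ) (hasseDeriv (h + j) P)‖ ≤
      Real.exp (-(n : ℝ) ^ ν) := by
    have hjh' : ((h + j : ℕ) : ℝ) ≤ (n : ℝ) ^ τ := by rwa [Nat.add_comm] at hjh
    exact hP.2.2.2 (a * c) (h + j) hac hjh'
  calc (a : ℝ) ^ (j + h) *
        ‖aeval (((a * c : ℕ) : ℂ) * ξ) (hasseDeriv h (hasseDeriv j P))‖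
      ≤ (a : ℝ) ^ (j + h) * (2 ^ (h + j) * Real.exp (-(n : ℝ) ^ ν)) :=
        mul_le_mul_of_nonneg_left (h2.trans (mul_le_mul_of_nonneg_left h3 (by positivity)))
          (by positivity)
    _ = (2 * a : ℝ) ^ (j + h) * Real.exp (-(n : ℝ) ^ ν) := by
        rw [mul_pow, Nat.add_comm h j]
        ring

/-- The exponential form used downstream: if `(2a)^{j+h} ≤ exp B` then the value is
`≤ exp(-(n^ν - B))`. -/
theorem soloDL_norm_aeval_le_exp {ξ : ℂ} {β σ τ ν : ℝ} {n : ℕ} {P : ℤ[X]}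
    (hP : P ∈ RoyAdditiveSmall ξ β σ τ ν n) {a c : ℕ}
    (hac : ((a * c : ℕ) : ℝ) ≤ (n : ℝ) ^ σ) {j h : ℕ}
    (hjh : ((j + h : ℕ) : ℝ) ≤ (n : ℝ) ^ τ) {B : ℝ}
    (hB : (2 * a : ℝ) ^ (j + h) ≤ Real.exp B) :
    ‖aeval ((c : ℂ) * ξ)
        (hasseDeriv h (hasseDeriv j (P.comp (C ((a : ℕ) : ℤ) * X))))‖ ≤
      Real.exp (-((n : ℝ) ^ ν - B)) := by
  refine (soloDL_norm_aeval_le hP hac hjh).trans ?_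
  rw [show -((n : ℝ) ^ ν - B) = B + -(n : ℝ) ^ ν by ring, Real.exp_add]
  exact mul_le_mul_of_nonneg_right hB (Real.exp_pos _).le

/-- The bound `(2a)^{j+h} ≤ exp(T · log(2a))` for `j + h ≤ T` and `a ≥ 1`
(so `log(2a) ≥ 0`). -/
theorem soloDL_pow_le_exp {a : ℕ} (ha : 1 ≤ a) {j h : ℕ} {T : ℝ}
    (hjh : ((j + h : ℕ) : ℝ) ≤ T) :
    (2 * a : ℝ) ^ (j + h) ≤ Real.exp (T * Real.log (2 * a)) := by
  have ha1 : (1 : ℝ) ≤ a := by exact_mod_cast ha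
  have h2a : (1 : ℝ) ≤ 2 * a := by linarith
  have hlog : 0 ≤ Real.log (2 * a) := Real.log_nonneg h2a
  rw [← Real.rpow_natCast, Real.rpow_def_of_pos (by linarith), mul_comm]
  exact Real.exp_le_exp.mpr (mul_le_mul_of_nonneg_right hjh hlog)

end Summit.Schanuel.Schanuel.Theorems
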